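import Literature.MathematicalPhysics.QuantumFieldTheory.Balaban1983to89.B4Eq213Locality
import Literature.MathematicalPhysics.QuantumFieldTheory.Balaban1983to89.B4Eq26Locality

/-!
# `Balaban1983to89.B4Eq213ConcreteWalk` — [Balaban1983RegularityDecay] (2.12)–(2.13) ⇒ (2.22)/(2.30): the random-walk
expansion and its decay bound INSTANTIATED on [B4]'s concrete operators with the constructed partition of unity — every
algebraic/combinatorial hypothesis of `B4RandomWalk213.lattice_walk_decay_bound` discharged, the analytic inputs explicit

statement-level skeleton of published theorems with citation tags; proofs where landed; nothing here is a claim about the Yang–Mills mass gap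

CITATION HEADER.  T. Bałaban, *Regularity and decay of lattice Green's functions*, Commun. Math. Phys. **89** (1983)
571–597, doi:10.1007/bf01214744 [Balaban1983RegularityDecay] (cell paper B4; held text
`paper:balaban1983-cmp89-regularity-decay`, journal page = PDF page + 570; pp. 575–581).  Unit `lit-balaban-r01` gen 5
(B4 fold owner), HOME `run/shared/lean/pub/lit-balaban/`, SKELETON rows **B4.Eq2.12** ((2.12)–(2.13)), **B4.Eq2.18**
((2.18)–(2.22)), **B4.Cor2.3** (the walk route to (2.30)).  Theorems only; imports `B4Eq213Locality` (→ `B4RandomWalk213`,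
`B4PartitionUnity22`) and `B4Eq26Locality`.  Norm: Mathlib's scope `Matrix.Norms.Operator` (`open scoped`) — `‖A‖ =
max_i Σ_j |A_ij|`, the `ℓ^∞ → ℓ^∞` operator norm of the `‖·‖_∞` factors of (2.20).

WHAT IS PRINTED (verbatim, p. 577).  *«In the sequel we will see that R is a small operator in reasonable norms because
|∂^ηh_j| ≤ O(M⁻¹), |Δ^ηh_j| ≤ O(M⁻²), so we have the representations (2.12) G_k(Ω,A) = G₀(I − R)⁻¹ = Σ_{n=0}^∞ G₀Rⁿ. They
can be written in a very convenient form of "random walk" representation … (2.13) … and this representation follows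
from (2.12) and the obvious fact that G_k(□_j,Ã_j)h_jK_{j′}G_k(□_{j′},Ã_{j′}) = 0, if |j − j′| > 1.»*; p. 579 (2.22) and
pp. 580–581 Corollary 2.3 (2.30) (the geometric-series bound over walks; typed abstractly as
`B4RandomWalk213.lattice_walk_decay_bound`).

WHAT THIS MODULE PROVES (all in full).
* `hasSum_neumann` — in the complete matrix ring with the `ℓ^∞`-operator norm, `‖R‖ < 1` and `G(1 − R) = G₀` give
  `G = Σ_n G₀Rⁿ` (convergent): (2.12) from «R is a small operator».
* `cut_local` — the Neumann-cut weights of `□_j` inherit the range of the bond weights.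
* **`concrete_walk_decay_bound`** — for ANY finite site set `X` with positions `pos : X → ℝ^d`, the operator
  `H = −Δ_W + m² + aQ^*Q` (1.6) with data local at scale `M/8` and its inverse `G` (`GH = 1`), labels `j ∈ s ⊇ supp`, cube
  operators `H_j` (Neumann cut at `S_j ⊇ (7/8)M`-cube; links/transporters `= A`'s on the `θ_j`-plateau) with inverses
  `G_j`, and [B4]'s CONCRETE letters `a_j = h_jG_jh_j` (2.2), `b_j = K_jG_jh_j` (2.11), `G₀ = Σ_j a_j`, `R = Σ_j b_j`:
  the conclusion of `B4RandomWalk213.lattice_walk_decay_bound`, `‖P·G·P′‖ ≤ |S₀|·α·β₁·3^d·(3^dβ)^{N−1}/(1 − 3^dβ)`, with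
  `hG₀`, `hRop` (definitions), `hG` (the series: `B4Eq26Locality.parametrix_identity_hCube` + `G_mul_one_sub_eq` +
  `hasSum_neumann`), `hab`, `hbb` (`B4Eq213Locality.mulH_hCube_mul_opK_eq_zero`) and the label geometry (`↥s ⊂ Z^d`,
  `cubeAdj` = `|i − l|_∞ ≤ 1`) DISCHARGED.  Remaining hypotheses, explicit: `‖R‖ < 1`; the factor bounds `α, β, β₁` with
  `3^dβ < 1` (Lemma 2.1 + the p.577 sizes — at zero field on boxes see `B4Eq220PartitionSizes.eq220_hBox`); the support
  cut-offs `P, P′` with label sets `S₀, S₁` at sup-distance `≥ N`.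

HONEST SCOPE.  This is the knitting of the cell's abstract walk machinery to the actual lattice operators and the
printed `h_j`; it does not prove Lemma 2.1/2.2 at `A ≠ 0`, nor `‖R‖ < 1`, nor choose `M`; the general-`Ω` Theorem
(1.9)/(1.10) at `A ≠ 0` remains the cell's reserve item R9.  No `def`, no `Prop` fact, no `sorry`; axioms standard.
-/

namespace Literature.MathematicalPhysics.QuantumFieldTheory.Balaban1983to89.B4Eq213ConcreteWalk

open Literature.MathematicalPhysics.QuantumFieldTheory.Balaban1983to89.B4GaugeCovariance
open Literature.MathematicalPhysics.QuantumFieldTheory.Balaban1983to89.B4Commutators25to211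
open Literature.MathematicalPhysics.QuantumFieldTheory.Balaban1983to89.B4PartitionUnity22
open Literature.MathematicalPhysics.QuantumFieldTheory.Balaban1983to89.B4RandomWalk213
open Literature.MathematicalPhysics.QuantumFieldTheory.Balaban1983to89.B4Eq213Locality
open Literature.MathematicalPhysics.QuantumFieldTheory.Balaban1983to89.B4Eq26Locality
open scoped Matrix

open scoped Matrix.Norms.Operator

variable {X Y κ : Type*} [Fintype X] [Fintype Y] [Fintype κ] [DecidableEq X] [DecidableEq κ] {d : ℕ}

/-- The matrix ring with the `ℓ^∞`-operator norm (`‖A‖ = max_i Σ_j |A_{ij}|`, Mathlib's scope `Matrix.Norms.Operator` —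
the norm of (2.20)'s `‖·‖_∞` factors) is complete, so the Neumann series (2.12) converges for `‖R‖ < 1`
(`B4RandomWalk213.hasSum_of_norm_lt_one`). [cite: Balaban1983RegularityDecay, (2.12) p.577] -/
theorem hasSum_neumann {G G₀ Rop : Matrix (X × κ) (X × κ) ℝ} (hR : ‖Rop‖ < 1) (hG : G * (1 - Rop) = G₀) :
    HasSum (fun n : ℕ => G₀ * Rop ^ n) G := by
  haveI : CompleteSpace (Matrix (X × κ) (X × κ) ℝ) := FiniteDimensional.complete ℝ (Matrix (X × κ) (X × κ) ℝ)
  exact hasSum_of_norm_lt_one hR hG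

omit [Fintype X] [DecidableEq X] in
/-- locality of the Neumann-cut weights: `1[z ∈ S ↔ z′ ∈ S]·c` inherits the range of `c`. [cite: Balaban1983RegularityDecay, (2.6) p.576] -/
theorem cut_local {M : ℝ} (pos : X → Fin d → ℝ) (c : X → X → ℝ) (S : X → Prop) [DecidablePred S] {r : ℝ}
    (hc : ∀ x z', c x z' ≠ 0 → ∀ μ, |pos x μ - pos z' μ| ≤ r * M) (z z' : X)
    (h : (if (S z ↔ S z') then c z z' else 0) ≠ 0) : ∀ μ, |pos z μ - pos z' μ| ≤ r * M := by
  by_cases hzz : (S z ↔ S z')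
  · rw [if_pos hzz] at h
    exact hc z z' h
  · rw [if_neg hzz] at h
    exact absurd rfl h

/-- **THE RANDOM-WALK EXPANSION (2.12)–(2.13) AND ITS DECAY BOUND (2.22)/(2.30), FOR [B4]'s CONCRETE OPERATORS AND
THE CONSTRUCTED PARTITION OF UNITY.**  Setting: any finite site set `X` with positions `pos : X → ℝ^d`, the operator
`H = −Δ_W + m² + aQ^*Q` (1.6) of `B4GaugeCovariance` with data local at scale `M/8`, its inverse `G = G_k(Ω,A)`
(`G·H = 1`), the labels `j ∈ s ⊇ {j : h_j ≠ 0 on X}`, the cube operators `H_j` (Neumann cut at `S_j ⊇ (7/8)M`-cube, links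
`Ã_j` equal to `A` on the plateau) with inverses `G_j` (`H_jG_j = 1`), `a_j = h_jG_jh_j` (2.2), `b_j = K_jG_jh_j` (2.11),
`G₀ = Σ_j a_j`, `R = Σ_j b_j`.  DISCHARGED here (kernel-checked, no analytic input): `H·G₀ = 1 − R`
(`B4Eq26Locality.parametrix_identity_hCube`), hence `G(1 − R) = G₀`; the locality `a_ib_l = 0 = b_ib_l` for
`|i − l|_∞ > 1` (`B4Eq213Locality`); the convergence of `Σ_n G₀Rⁿ` to `G` in the `ℓ^∞`-operator norm GIVEN `‖R‖ < 1`.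
REMAINING HYPOTHESES (the analytic inputs of pp. 577–581, explicit): `‖R‖ < 1` («R is a small operator»), the factor
bounds `‖Pa_j‖ ≤ α`, `‖b_j‖ ≤ β`, `‖b_jP′‖ ≤ β₁` with `3^dβ < 1` (Lemma 2.1 (2.15) + «|∂^ηh_j| ≤ O(M⁻¹)»; cf.
`B4Eq220PartitionSizes` at zero field), and the support cut-offs `P`, `P′` with label sets `S₀`, `S₁` at sup-distance
`≥ N`.  CONCLUSION = `B4RandomWalk213.lattice_walk_decay_bound`:
`‖P·G·P′‖ ≤ |S₀|·α·β₁·3^d·(3^dβ)^{N−1}/(1 − 3^dβ)`. [cite: Balaban1983RegularityDecay, (2.13) p.577, (2.22) p.579] -/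
theorem concrete_walk_decay_bound {M : ℝ} (hM : 0 < M) (pos : X → Fin d → ℝ) (c : X → X → ℝ) (m2 a : ℝ)
    (q : Y → X → ℝ) (W : X → X → Matrix κ κ ℝ) (T : Y → X → Matrix κ κ ℝ)
    (hc : ∀ x z', c x z' ≠ 0 → ∀ μ, |pos x μ - pos z' μ| ≤ 1 / 8 * M)
    (hq : ∀ y x z', q y x ≠ 0 → q y z' ≠ 0 → ∀ μ, |pos x μ - pos z' μ| ≤ 1 / 8 * M)
    (s : Finset (Fin d → ℤ)) (hs : ∀ j x, hCube M j (pos x) ≠ 0 → j ∈ s)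
    (S : (Fin d → ℤ) → X → Prop) [∀ j, DecidablePred (S j)]
    (hS : ∀ j z, (∀ μ, |pos z μ - M * j μ| ≤ 7 / 8 * M) → S j z)
    (W' : (Fin d → ℤ) → X → X → Matrix κ κ ℝ) (T' : (Fin d → ℤ) → Y → X → Matrix κ κ ℝ)
    (hWW' : ∀ j x z', (∀ μ, |pos x μ - M * j μ| ≤ 3 / 4 * M) → (∀ μ, |pos z' μ - M * j μ| ≤ 3 / 4 * M) →
      W' j x z' = W x z')
    (hTT' : ∀ j y x, q y x ≠ 0 → (∀ μ, |pos x μ - M * j μ| ≤ 3 / 4 * M) → T' j y x = T y x)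
    (Gj : (Fin d → ℤ) → Matrix (X × κ) (X × κ) ℝ)
    (hGj : ∀ j ∈ s, covOp (fun z z' => if (S j z ↔ S j z') then c z z' else 0) m2 a q (W' j) (T' j) * Gj j = 1)
    (G : Matrix (X × κ) (X × κ) ℝ) (hGH : G * covOp c m2 a q W T = 1)
    -- the analytic inputs
    (hR : ‖∑ j ∈ s, opK (fun z z' => if (S j z ↔ S j z') then c z z' else 0) m2 a q (W' j) (T' j)
        (fun z => hCube M j (pos z)) * Gj j * mulH (ι := κ) (fun z => hCube M j (pos z))‖ < 1)
    {P P' : Matrix (X × κ) (X × κ) ℝ} {S₀ S₁ : Finset ↥s} {α β β₁ : ℝ} {N : ℕ}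
    (hP : ∀ i : ↥s, i ∉ S₀ →
      P * (mulH (ι := κ) (fun z => hCube M i.1 (pos z)) * Gj i.1 * mulH (ι := κ) (fun z => hCube M i.1 (pos z))) = 0)
    (hP'a : ∀ i : ↥s, i ∉ S₁ →
      mulH (ι := κ) (fun z => hCube M i.1 (pos z)) * Gj i.1 * mulH (ι := κ) (fun z => hCube M i.1 (pos z)) * P' = 0)
    (hP'b : ∀ i : ↥s, i ∉ S₁ →
      opK (fun z z' => if (S i.1 z ↔ S i.1 z') then c z z' else 0) m2 a q (W' i.1) (T' i.1)
        (fun z => hCube M i.1 (pos z)) * Gj i.1 * mulH (ι := κ) (fun z => hCube M i.1 (pos z)) * P' = 0)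
    (hα : ∀ i : ↥s,
      ‖P * (mulH (ι := κ) (fun z => hCube M i.1 (pos z)) * Gj i.1 * mulH (ι := κ) (fun z => hCube M i.1 (pos z)))‖ ≤ α)
    (hβ0 : 0 ≤ β)
    (hβ : ∀ i : ↥s, ‖opK (fun z z' => if (S i.1 z ↔ S i.1 z') then c z z' else 0) m2 a q (W' i.1) (T' i.1)
        (fun z => hCube M i.1 (pos z)) * Gj i.1 * mulH (ι := κ) (fun z => hCube M i.1 (pos z))‖ ≤ β)
    (hβ₁ : ∀ i : ↥s, ‖opK (fun z z' => if (S i.1 z ↔ S i.1 z') then c z z' else 0) m2 a q (W' i.1) (T' i.1)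
        (fun z => hCube M i.1 (pos z)) * Gj i.1 * mulH (ι := κ) (fun z => hCube M i.1 (pos z)) * P'‖ ≤ β₁)
    (h3β : (3 : ℝ) ^ d * β < 1) (hN : 1 ≤ N)
    (hsep : ∀ i ∈ S₀, ∀ l ∈ S₁, ∃ μ, (N : ℤ) ≤ |i.1 μ - l.1 μ|) :
    ‖P * G * P'‖ ≤ S₀.card * α * β₁ * (3 : ℝ) ^ d * ((3 : ℝ) ^ d * β) ^ (N - 1) / (1 - (3 : ℝ) ^ d * β) := by
  -- the letters of `B4RandomWalk213` for the concrete data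
  set h : (Fin d → ℤ) → X → ℝ := fun j z => hCube M j (pos z) with hh
  set cut : (Fin d → ℤ) → X → X → ℝ := fun j z z' => if (S j z ↔ S j z') then c z z' else 0 with hcut
  set aJ : (Fin d → ℤ) → Matrix (X × κ) (X × κ) ℝ :=
    fun j => mulH (ι := κ) (h j) * Gj j * mulH (ι := κ) (h j) with haJ
  set bJ : (Fin d → ℤ) → Matrix (X × κ) (X × κ) ℝ :=
    fun j => opK (cut j) m2 a q (W' j) (T' j) (h j) * Gj j * mulH (ι := κ) (h j) with hbJ
  -- (2.9)–(2.11): `H·G₀ = 1 − R`, hence (2.12) `G(1 − R) = G₀` and the convergent Neumann series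
  have h211 : covOp c m2 a q W T * ∑ j ∈ s, aJ j = 1 - ∑ j ∈ s, bJ j :=
    parametrix_identity_hCube hM pos c m2 a q W T s hs S hS hc hq W' T' hWW' hTT' Gj hGj
  have hGeq : G * (1 - ∑ j ∈ s, bJ j) = ∑ j ∈ s, aJ j := G_mul_one_sub_eq hGH h211
  have hsum : HasSum (fun n : ℕ => (∑ j ∈ s, aJ j) * (∑ j ∈ s, bJ j) ^ n) G := hasSum_neumann hR hGeq
  -- locality of the cube data at scale `(3/4)M`
  have hM8 : 1 / 8 * M ≤ 3 / 4 * M := by nlinarith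
  have hcut_loc : ∀ l z z', cut l z z' ≠ 0 → ∀ μ, |pos z μ - pos z' μ| ≤ 3 / 4 * M :=
    fun l z z' hne μ => (cut_local pos c (S l) hc z z' hne μ).trans hM8
  have hq_loc : ∀ y z z', q y z ≠ 0 → q y z' ≠ 0 → ∀ μ, |pos z μ - pos z' μ| ≤ 3 / 4 * M :=
    fun y z z' h1 h2 μ => (hq y z z' h1 h2 μ).trans hM8
  have hloc : ∀ i l : ↥s, ¬ cubeAdj (fun i : ↥s => i.1) i l →
      mulH (ι := κ) (h i.1) * opK (cut l.1) m2 a q (W' l.1) (T' l.1) (h l.1) = 0 :=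
    fun i l hil => mulH_hCube_mul_opK_eq_zero hM pos (cut l.1) m2 a q (W' l.1) (T' l.1) (hcut_loc l.1) hq_loc hil
  have hab : ∀ i l : ↥s, ¬ cubeAdj (fun i : ↥s => i.1) i l → aJ i.1 * bJ l.1 = 0 := by
    intro i l hil
    simp only [haJ, hbJ]
    rw [show mulH (ι := κ) (h i.1) * Gj i.1 * mulH (ι := κ) (h i.1)
          * (opK (cut l.1) m2 a q (W' l.1) (T' l.1) (h l.1) * Gj l.1 * mulH (ι := κ) (h l.1))
        = mulH (ι := κ) (h i.1) * Gj i.1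
          * (mulH (ι := κ) (h i.1) * opK (cut l.1) m2 a q (W' l.1) (T' l.1) (h l.1))
          * Gj l.1 * mulH (ι := κ) (h l.1) by simp only [Matrix.mul_assoc],
      hloc i l hil, Matrix.mul_zero, Matrix.zero_mul, Matrix.zero_mul]
  have hbb : ∀ i l : ↥s, ¬ cubeAdj (fun i : ↥s => i.1) i l → bJ i.1 * bJ l.1 = 0 := by
    intro i l hil
    simp only [hbJ]
    rw [show opK (cut i.1) m2 a q (W' i.1) (T' i.1) (h i.1) * Gj i.1 * mulH (ι := κ) (h i.1)
          * (opK (cut l.1) m2 a q (W' l.1) (T' l.1) (h l.1) * Gj l.1 * mulH (ι := κ) (h l.1))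
        = opK (cut i.1) m2 a q (W' i.1) (T' i.1) (h i.1) * Gj i.1
          * (mulH (ι := κ) (h i.1) * opK (cut l.1) m2 a q (W' l.1) (T' l.1) (h l.1))
          * Gj l.1 * mulH (ι := κ) (h l.1) by simp only [Matrix.mul_assoc],
      hloc i l hil, Matrix.mul_zero, Matrix.zero_mul, Matrix.zero_mul]
  -- the abstract walk bound over the finite label type `↥s`
  exact lattice_walk_decay_bound (fun i : ↥s => i.1) Subtype.val_injective
    (a := fun i : ↥s => aJ i.1) (b := fun i : ↥s => bJ i.1)
    (by rw [Finset.sum_coe_sort s aJ]) (by rw [Finset.sum_coe_sort s bJ]) hsum hab hbb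
    hP hP'a hP'b hα hβ0 hβ hβ₁ h3β hN hsep

end Literature.MathematicalPhysics.QuantumFieldTheory.Balaban1983to89.B4Eq213ConcreteWalk
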